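import Literature.Topology.FourManifolds.PlumbingFamilyDistance
import Literature.Topology.FourManifolds.PlumbingAdaptedChartNormalised
import Literature.Topology.FourManifolds.SphereFamilySurgeryTransport
import HarnessLib

/-!
# The plumbed neighbourhood of the middle-level configuration as a regular sublevel set

Topic `Literature/Topology/FourManifolds` (fact seat
`provefact-Literature.Topology.FourManifolds.Matvey-69322e0896`, rung (H4)
`Literature.Topology.FourManifolds.Matveyev1996_partOne_and_fact_of_dualSpheres` of
`CorkDecompositionMiddleLevel.lean`).  The printed proofs of the cork decomposition theorem
begin, in the middle level `N` of the two-three handlebody, with the regular neighbourhood of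
the configuration of the two families of embedded 2-spheres — Matveyev 1996
(arXiv:dg-ga/9505001), Proof of Theorem, p. 1: *"We have two algebraically dual collections
of embedded 2-spheres `{Sᵢ} ⊂ N`, `{Pᵢ} ⊂ N` […]. Put `V₀ = Nd_N(S_* ∪ P_*)`"*; Kirby 1996
(arXiv:math/9712231), §3 (the handles `0 ∪ 1 ∪ H_{k,i}` carried by the spheres) — the union
of the tubes about the `Sᵢ` and about the `Pⱼ`, plumbed at the finitely many transverse
crossings (Milnor, *Lectures on the h-cobordism theorem* (1965), PDF p. 27: complementary
coordinate planes of a chart) with the corners rounded (Milnor 1965, §1; Kosinski,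
*Differential Manifolds* (1993), VI.5).  This file realises `V₀` in the format of the tree:
a regular sublevel set `{g ≤ 0}` of a smooth function `g : N → ℝ` with regular level `0`
(`RegularLevelSplitting.lean`), containing closed tubes about all the spheres of both
families and contained in the union of the open tubes — exactly the input of
`Literature.Topology.FourManifolds.FramedSphereFamily.exists_common_exterior_of_isSurgery`
(`SurgeryRegularDomain.lean`, Matveyev's step 3).  The function is
`g = μ(H_S, H_P) - ε²` for the two family distance functions of
`PlumbingFamilyDistance.lean` (built on the adapted charts of
`PlumbingAdaptedChartNormalised.lean` at the crossings, with bump functions concentrated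
there) and the smooth minimum `μ` of `RegularNeighbourhoodPrelim.lean`; its zero level is
regular because away from the crossings it is a non-critical level of `H_S` or of `H_P`, and
near a crossing, in the adapted chart `(X, Y)`, `g = μ(‖Y‖², ‖X‖²) - ε²` with `X ≠ 0 ≠ Y` on
the level.  Everything is proved; no definitions, no named facts:

* `Literature.Topology.FourManifolds.FramedSphereFamily.not_isMCriticalPt_of_eventuallyEq_sub_const`
  — a function locally equal to `H - e` is critical only where `H` is;
* `Literature.Topology.FourManifolds.FramedSphereFamily.not_isMCriticalPt_smoothMin_of_chart`
  — **the corner computation**: in a chart `Ψ = (X, Y)` about `z` in which `H_S = ‖Y‖²` and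
  `H_P = ‖X‖²` near `z`, with `H_S(z), H_P(z) > 0`, the function `μ(H_S, H_P) - ε²` is not
  critical at `z` whenever `dμ = s du + (1 - s) dv` at `(H_S z, H_P z)`;
* `Literature.Topology.FourManifolds.FramedSphereFamily.exists_isRegularLevel_plumbing` —
  **the plumbed neighbourhood**: for finite framed families `S` (of `a`-spheres, fibre `ℝᵇ`)
  and `P` (of `b`-spheres, fibre `ℝᵃ`) in a closed `(n + 1)`-manifold, `a + b = n + 1`,
  whose core spheres are pairwise transverse (`Literature.Topology.FourManifolds.MapsTransverse`,
  the general-position clause of `Literature.Topology.FourManifolds.IsAlgebraicallyDual`),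
  there are a smooth `g : N → ℝ` with regular level `0` and a radius `0 < r ≤ 1` such that
  the closed `r`-tubes `φᵢ(Sᵃ × B̄(0, r))`, `φ'ⱼ(Sᵇ × B̄(0, r))` lie in `{g < 0}` and
  `{g ≤ 0}` lies in the union of the open tubes `φᵢ(Sᵃ × ℝᵇ) ∪ φ'ⱼ(Sᵇ × ℝᵃ)`.

## References

* R. Matveyev, *A decomposition of smooth simply-connected h-cobordant 4-manifolds*,
  J. Differential Geom. 44 (1996) 571–582; arXiv:dg-ga/9505001, Proof of Theorem, p. 1.
  [Matveyev1996]
* R. Kirby, *Akbulut's corks and h-cobordisms of smooth, simply connected 4-manifolds*, Turkish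
  J. Math. 20 (1996) 85–93; arXiv:math/9712231, §3. [KirbyCorks1996]
* J. Milnor, *Lectures on the h-cobordism theorem*, Princeton (1965), §1 (rounding corners),
  Def. 3.9 (PDF p. 16), Def. 5.1 (PDF p. 26), PDF p. 27. [MilnorHCobordism1965]
* A. A. Kosinski, *Differential Manifolds* (1993), IV.1.6, VI.5. [Kosinski1993]
-/

open scoped Manifold ContDiff Topology InnerProductSpace
open Set Function Filter

noncomputable section

namespace Literature.Topology.FourManifolds

universe u v w

namespace FramedSphereFamily

variable {n a b : ℕ} {N : Type u} [TopologicalSpace N] [T2Space N]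
  [ChartedSpace (EuclideanSpace ℝ (Fin (n + 1))) N] [IsManifold (𝓡 (n + 1)) ∞ N]

/-! ### Two lemmas on critical points -/

omit [T2Space N] [IsManifold (𝓡 (n + 1)) ∞ N] in
/-- A function which near `z` is `H - e` for a constant `e` is critical at `z` only if `H`
is. [folklore] -/
theorem not_isMCriticalPt_of_eventuallyEq_sub_const {g H : N → ℝ} {z : N} {e : ℝ}
    (hev : g =ᶠ[𝓝 z] fun y => H y - e) (hH : MDifferentiableAt (𝓡 (n + 1)) 𝓘(ℝ, ℝ) H z)
    (hreg : ¬ IsMCriticalPt (𝓡 (n + 1)) H z) : ¬ IsMCriticalPt (𝓡 (n + 1)) g z := by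
  intro hc
  apply hreg
  have h1 : HasMFDerivAt 𝓘(ℝ, ℝ) 𝓘(ℝ, ℝ) (fun t : ℝ => t - e) (H z)
      (ContinuousLinearMap.id ℝ ℝ) :=
    ((hasFDerivAt_id (H z)).sub_const e).hasMFDerivAt
  have h2 : HasMFDerivAt (𝓡 (n + 1)) 𝓘(ℝ, ℝ) (fun y => H y - e) z
      ((ContinuousLinearMap.id ℝ ℝ).comp (mfderiv (𝓡 (n + 1)) 𝓘(ℝ, ℝ) H z)) :=
    h1.comp z hH.hasMFDerivAt
  have h3 : mfderiv (𝓡 (n + 1)) 𝓘(ℝ, ℝ) (fun y => H y - e) z =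
      mfderiv (𝓡 (n + 1)) 𝓘(ℝ, ℝ) H z := by
    rw [h2.mfderiv, ContinuousLinearMap.id_comp]
  unfold IsMCriticalPt at hc ⊢
  rw [hev.mfderiv_eq, h3] at hc
  exact hc

omit [T2Space N] [IsManifold (𝓡 (n + 1)) ∞ N] in
/-- **The corner computation** (rounding the corner of the plumbing, Milnor 1965, §1;
Kosinski 1993, VI.5).  Let `Ψ : N ⇀ ℝᵃ × ℝᵇ` be a chart about `z`, smooth with smooth
inverse, in which near `z` two functions read `H_S = ‖Ψ₂‖²` and `H_P = ‖Ψ₁‖²`, with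
`H_S(z) > 0` and `H_P(z) > 0`, and let `μ : ℝ × ℝ → ℝ` have differential
`s du + (1 - s) dv` at `(H_S z, H_P z)`.  Then `z` is not a critical point of
`μ(H_S, H_P) - ε²`: in the chart the differential is
`2 s ⟨Y, dY⟩ + 2 (1 - s) ⟨X, dX⟩` with `X = Ψ₁ z ≠ 0`, `Y = Ψ₂ z ≠ 0`, which vanishes only
if `s = 0` and `1 - s = 0`. [cite: MilnorHCobordism1965, §1 (after Thm. 1.4)] [cite: Kosinski1993, Ch. VI §5] -/
theorem not_isMCriticalPt_smoothMin_of_chart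
    (Ψ : OpenPartialHomeomorph N (EuclideanSpace ℝ (Fin a) × EuclideanSpace ℝ (Fin b)))
    (hΨ : ContMDiffOn (𝓡 (n + 1)) 𝓘(ℝ, EuclideanSpace ℝ (Fin a) × EuclideanSpace ℝ (Fin b)) ∞
      Ψ Ψ.source)
    (hΨ' : ContMDiffOn 𝓘(ℝ, EuclideanSpace ℝ (Fin a) × EuclideanSpace ℝ (Fin b)) (𝓡 (n + 1)) ∞
      Ψ.symm Ψ.target)
    {z : N} (hz : z ∈ Ψ.source) {HS HP : N → ℝ}
    (hS : HS =ᶠ[𝓝 z] fun y => ‖(Ψ y).2‖ ^ 2) (hP : HP =ᶠ[𝓝 z] fun y => ‖(Ψ y).1‖ ^ 2)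
    (h0S : 0 < HS z) (h0P : 0 < HP z) {μ : ℝ × ℝ → ℝ} {s : ℝ}
    (hμ : HasFDerivAt μ
      (s • ContinuousLinearMap.fst ℝ ℝ ℝ + (1 - s) • ContinuousLinearMap.snd ℝ ℝ ℝ) (HS z, HP z))
    (ε2 : ℝ) :
    ¬ IsMCriticalPt (𝓡 (n + 1)) (fun y => μ (HS y, HP y) - ε2) z := by
  intro hc
  -- the chart values at `z`
  have hzt : Ψ z ∈ Ψ.target := Ψ.map_source hz
  have hsymm : Ψ.symm (Ψ z) = z := Ψ.left_inv hz
  have hXz : HP z = ‖(Ψ z).1‖ ^ 2 := hP.eq_of_nhds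
  have hYz : HS z = ‖(Ψ z).2‖ ^ 2 := hS.eq_of_nhds
  have hX : ‖(Ψ z).1‖ ≠ 0 := fun h => by
    rw [hXz, h] at h0P
    norm_num at h0P
  have hY : ‖(Ψ z).2‖ ≠ 0 := fun h => by
    rw [hYz, h] at h0S
    norm_num at h0S
  -- the model function and its derivative at `Ψ z`
  set Gc : EuclideanSpace ℝ (Fin a) × EuclideanSpace ℝ (Fin b) → ℝ :=
    fun p => μ (‖p.2‖ ^ 2, ‖p.1‖ ^ 2) - ε2 with hGc
  set L₁ : EuclideanSpace ℝ (Fin a) × EuclideanSpace ℝ (Fin b) →L[ℝ] ℝ :=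
    2 • (innerSL ℝ (Ψ z).2).comp
      (ContinuousLinearMap.snd ℝ (EuclideanSpace ℝ (Fin a)) (EuclideanSpace ℝ (Fin b))) with hL₁
  set L₂ : EuclideanSpace ℝ (Fin a) × EuclideanSpace ℝ (Fin b) →L[ℝ] ℝ :=
    2 • (innerSL ℝ (Ψ z).1).comp
      (ContinuousLinearMap.fst ℝ (EuclideanSpace ℝ (Fin a)) (EuclideanSpace ℝ (Fin b))) with hL₂
  have hν : HasFDerivAt
      (fun p : EuclideanSpace ℝ (Fin a) × EuclideanSpace ℝ (Fin b) => (‖p.2‖ ^ 2, ‖p.1‖ ^ 2))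
      (L₁.prod L₂) (Ψ z) :=
    (hasFDerivAt_snd (𝕜 := ℝ) (p := Ψ z)).norm_sq.prodMk
      (hasFDerivAt_fst (𝕜 := ℝ) (p := Ψ z)).norm_sq
  have hμ' : HasFDerivAt μ
      (s • ContinuousLinearMap.fst ℝ ℝ ℝ + (1 - s) • ContinuousLinearMap.snd ℝ ℝ ℝ)
      ((fun p : EuclideanSpace ℝ (Fin a) × EuclideanSpace ℝ (Fin b) =>
        (‖p.2‖ ^ 2, ‖p.1‖ ^ 2)) (Ψ z)) := by
    rw [show ((fun p : EuclideanSpace ℝ (Fin a) × EuclideanSpace ℝ (Fin b) =>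
        (‖p.2‖ ^ 2, ‖p.1‖ ^ 2)) (Ψ z)) = (HS z, HP z) from by rw [hYz, hXz]]
    exact hμ
  have hG : HasFDerivAt Gc
      ((s • ContinuousLinearMap.fst ℝ ℝ ℝ + (1 - s) • ContinuousLinearMap.snd ℝ ℝ ℝ).comp
        (L₁.prod L₂)) (Ψ z) :=
    (hμ'.comp (Ψ z) hν).sub_const ε2
  -- the derivative does not vanish: test against `(X, 0)` and `(0, Y)`
  have hL : (s • ContinuousLinearMap.fst ℝ ℝ ℝ + (1 - s) • ContinuousLinearMap.snd ℝ ℝ ℝ).comp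
      (L₁.prod L₂) ≠ 0 := by
    intro h0
    have h1 := congrArg (fun T : EuclideanSpace ℝ (Fin a) × EuclideanSpace ℝ (Fin b) →L[ℝ] ℝ =>
      T ((Ψ z).1, 0)) h0
    have h2 := congrArg (fun T : EuclideanSpace ℝ (Fin a) × EuclideanSpace ℝ (Fin b) →L[ℝ] ℝ =>
      T (0, (Ψ z).2)) h0
    simp only [hL₁, hL₂, ContinuousLinearMap.comp_apply, ContinuousLinearMap.prod_apply,
      add_apply, smul_apply, ContinuousLinearMap.coe_fst', ContinuousLinearMap.coe_snd',
      innerSL_apply_apply, inner_zero_right, real_inner_self_eq_norm_sq, smul_eq_mul,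
      nsmul_eq_mul, Nat.cast_ofNat, zero_apply] at h1 h2
    -- `h1 : 2 (1 - s) ‖X‖² = 0`, `h2 : 2 s ‖Y‖² = 0` (up to normal form)
    have hX2 : (‖(Ψ z).1‖ ^ 2 : ℝ) ≠ 0 := pow_ne_zero 2 hX
    have hY2 : (‖(Ψ z).2‖ ^ 2 : ℝ) ≠ 0 := pow_ne_zero 2 hY
    have e1 : (1 - s) * ‖(Ψ z).1‖ ^ 2 = 0 := by linear_combination (1 / 2 : ℝ) * h1
    have e2 : s * ‖(Ψ z).2‖ ^ 2 = 0 := by linear_combination (1 / 2 : ℝ) * h2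
    have hs1 : 1 - s = 0 := by
      rcases mul_eq_zero.1 e1 with h | h
      · exact h
      · exact absurd h hX2
    have hs0 : s = 0 := by
      rcases mul_eq_zero.1 e2 with h | h
      · exact h
      · exact absurd h hY2
    rw [hs0] at hs1
    norm_num at hs1
  -- the function upstairs is the model function read in the chart, near `z` …
  have hgev : (fun y => μ (HS y, HP y) - ε2) =ᶠ[𝓝 z] fun y => Gc (Ψ y) := by
    filter_upwards [hS, hP] with y hyS hyP
    simp only [hGc, hyS, hyP]
  -- … and the model function is the function upstairs read through `Ψ⁻¹`, near `Ψ z`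
  have hGev : Gc =ᶠ[𝓝 (Ψ z)] ((fun y => μ (HS y, HP y) - ε2) ∘ Ψ.symm) := by
    have h1 : ∀ᶠ p in 𝓝 (Ψ z), p ∈ Ψ.target := Ψ.open_target.mem_nhds hzt
    have hca : ContinuousAt Ψ.symm (Ψ z) := Ψ.continuousAt_symm hzt
    have h2 : ∀ᶠ p in 𝓝 (Ψ z), μ (HS (Ψ.symm p), HP (Ψ.symm p)) - ε2 = Gc (Ψ (Ψ.symm p)) :=
      hca.eventually (show ∀ᶠ y in 𝓝 (Ψ.symm (Ψ z)), μ (HS y, HP y) - ε2 = Gc (Ψ y) from by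
        rw [hsymm]; exact hgev)
    filter_upwards [h1, h2] with p hp hp2
    rw [Function.comp_apply, hp2, Ψ.right_inv hp]
  -- differentiability
  have hΨd : MDifferentiableAt (𝓡 (n + 1)) 𝓘(ℝ, EuclideanSpace ℝ (Fin a) × EuclideanSpace ℝ (Fin b))
      Ψ z := (hΨ.contMDiffAt (Ψ.open_source.mem_nhds hz)).mdifferentiableAt (by simp)
  have hΨ'd : MDifferentiableAt 𝓘(ℝ, EuclideanSpace ℝ (Fin a) × EuclideanSpace ℝ (Fin b)) (𝓡 (n + 1))
      Ψ.symm (Ψ z) := (hΨ'.contMDiffAt (Ψ.open_target.mem_nhds hzt)).mdifferentiableAt (by simp)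
  have hGd : MDifferentiableAt 𝓘(ℝ, EuclideanSpace ℝ (Fin a) × EuclideanSpace ℝ (Fin b)) 𝓘(ℝ, ℝ)
      Gc (Ψ z) := hG.differentiableAt.mdifferentiableAt
  have hgd : MDifferentiableAt (𝓡 (n + 1)) 𝓘(ℝ, ℝ) (fun y => μ (HS y, HP y) - ε2) z :=
    (hGd.comp z hΨd).congr_of_eventuallyEq hgev
  -- the critical point downstairs
  have hc' : IsMCriticalPt (𝓡 (n + 1)) (fun y => μ (HS y, HP y) - ε2) (Ψ.symm (Ψ z)) := by
    rwa [hsymm]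
  have hgd' : MDifferentiableAt (𝓡 (n + 1)) 𝓘(ℝ, ℝ) (fun y => μ (HS y, HP y) - ε2)
      (Ψ.symm (Ψ z)) := by rwa [hsymm]
  have hcomp := IsMCriticalPt.comp (j := Ψ.symm) (a := Ψ z) hc' hgd' hΨ'd
  unfold IsMCriticalPt at hcomp
  rw [← hGev.mfderiv_eq, mfderiv_eq_fderiv, hG.fderiv] at hcomp
  exact hL hcomp

/-! ### The plumbed neighbourhood -/

variable [CompactSpace N] {ι : Type v} {ι' : Type w} [Finite ι] [Finite ι']

/-- **The plumbed neighbourhood of the middle-level configuration as a regular sublevel set**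
(Matveyev 1996, p. 1: *"Put `V₀ = Nd_N(S_* ∪ P_*)`"*; Kirby 1996, §3; the plumbing of the
tubes at the transverse crossings, Milnor 1965, PDF p. 27, with the corners rounded, §1).
Let `S` be a finite framed family of `a`-spheres with `b`-dimensional fibre and `P` a finite
framed family of `b`-spheres with `a`-dimensional fibre in the closed `(n + 1)`-manifold `N`,
`a + b = n + 1`, whose core spheres are pairwise transverse
(`Literature.Topology.FourManifolds.MapsTransverse`, as in
`Literature.Topology.FourManifolds.IsAlgebraicallyDual`).  Then there are a `C^∞` function
`g : N → ℝ` of which `0` is a regular level (`Literature.Topology.FourManifolds.IsRegularLevel`)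
and a radius `0 < r ≤ 1` such that the closed `r`-tubes about all the spheres of both
families lie in `{g < 0}` — so that, after rescaling the framings
(`FramedSphereFamily.exists_rescale`), `{g ≤ 0}` is a regular domain containing the closed
unit tubes, the input of `FramedSphereFamily.exists_common_exterior_of_isSurgery` — and
`{g ≤ 0}` lies inside the union of the open tubes of `S` and of `P`.  Construction:
`g = μ(H_S, H_P) - ε²` with the family distance functions `H_S`, `H_P` of
`FramedSphereFamily.exists_familyDistance` built on the adapted charts
(`FramedSphereFamily.exists_adaptedChart`) at the finitely many crossings
(`FramedSphereFamily.finite_inter_range_sphere_of_mapsTransverse`) with disjointly supported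
bump functions concentrated there, and the smooth minimum `μ` of `exists_smoothMin`; the level
`0` is regular by `not_isMCriticalPt_smoothMin_of_chart` near the crossings (where both
`H_S`, `H_P` are small, `exists_pos_forall_le_le_mem`) and because elsewhere `g` is locally
`H_S - ε²` or `H_P - ε²` at a non-critical level.
[cite: Matveyev1996, Proof of Theorem (arXiv p. 1)] [cite: KirbyCorks1996, §3]
[cite: MilnorHCobordism1965, §1 (after Thm. 1.4), Def. 5.1 (PDF p. 26), PDF p. 27] -/
theorem exists_isRegularLevel_plumbing (hab : a + b = n + 1) (hba : b + a = n + 1)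
    (S : FramedSphereFamily (𝓡 (n + 1)) N ι a b) (P : FramedSphereFamily (𝓡 (n + 1)) N ι' b a)
    (ht : ∀ i j, MapsTransverse (𝓡 a) (𝓡 b) (𝓡 (n + 1)) hab (S.sphere i) (P.sphere j)) :
    ∃ (g : N → ℝ) (r : ℝ), IsRegularLevel (𝓡 (n + 1)) g 0 ∧ 0 < r ∧ r ≤ 1 ∧
      (∀ i v w, ‖w‖ ≤ r → g (S.toFun i (v, w)) < 0) ∧
      (∀ j v w, ‖w‖ ≤ r → g (P.toFun j (v, w)) < 0) ∧
      (∀ z, g z ≤ 0 → (∃ i, z ∈ range (S.toFun i)) ∨ ∃ j, z ∈ range (P.toFun j)) := by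
  classical
  -- ### the crossings
  set C : Set N := S.cores ∩ P.cores with hC_def
  have hCfin : C.Finite := by
    have h1 : C ⊆ ⋃ i, ⋃ j, (range (S.sphere i) ∩ range (P.sphere j)) := by
      rintro z ⟨hzS, hzP⟩
      obtain ⟨i, x, rfl⟩ := S.mem_cores_iff.1 hzS
      obtain ⟨j, y, hy⟩ := P.mem_cores_iff.1 hzP
      exact mem_iUnion.2 ⟨i, mem_iUnion.2 ⟨j, mem_range_self x, y, hy⟩⟩
    refine Set.Finite.subset (Set.finite_iUnion fun i => Set.finite_iUnion fun j => ?_) h1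
    exact S.finite_inter_range_sphere_of_mapsTransverse hab (P.isSmoothEmbedding_sphere hba j) i
      (ht i j)
  haveI : Fintype C := hCfin.fintype
  have hcS : ∀ c : C, ∃ i x, S.sphere i x = c := fun c => S.mem_cores_iff.1 c.2.1
  have hcP : ∀ c : C, ∃ j y, P.sphere j y = c := fun c => P.mem_cores_iff.1 c.2.2
  choose iS xS hxS using hcS
  choose jP yP hyP using hcP
  have hcr : ∀ c : C, S.sphere (iS c) (xS c) = P.sphere (jP c) (yP c) :=
    fun c => (hxS c).trans (hyP c).symm
  -- ### the adapted charts
  have hchart := fun c : C => S.exists_adaptedChart hab hba P (hcr c) (ht _ _ _ _ (hcr c))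
  choose Ψ hΨc hΨ00 hΨsm hΨsm' hΨS hΨP hΨnS hΨnP using hchart
  have hΨc' : ∀ c : C, (c : N) ∈ (Ψ c).source := fun c => by rw [← hxS c]; exact hΨc c
  -- ### disjointly supported bumps concentrated at the crossings
  obtain ⟨U, hU, hUdisj⟩ := hCfin.t2_separation
  have hO : ∀ c : C, ∃ O : Set N, IsOpen O ∧ (c : N) ∈ O ∧ O ⊆ U c ∧ O ⊆ (Ψ c).source ∧
      O ⊆ range (S.toFun (iS c)) ∧ O ⊆ range (P.toFun (jP c)) := fun c =>
    ⟨((U c ∩ (Ψ c).source) ∩ range (S.toFun (iS c))) ∩ range (P.toFun (jP c)),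
      (((hU c).2.inter (Ψ c).open_source).inter (S.isOpen_range _)).inter (P.isOpen_range _),
      ⟨⟨⟨(hU c).1, hΨc' c⟩, by rw [← hxS c]; exact ⟨(xS c, 0), rfl⟩⟩,
        by rw [← hyP c]; exact ⟨(yP c, 0), rfl⟩⟩,
      fun z hz => hz.1.1.1, fun z hz => hz.1.1.2, fun z hz => hz.1.2, fun z hz => hz.2⟩
  choose O hOo hcO hOU hOΨ hOS hOP using hO
  have hbump : ∀ c : C, ∃ f : SmoothBumpFunction (𝓡 (n + 1)) (c : N), tsupport f ⊆ O c := by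
    intro c
    obtain ⟨f, -, hf⟩ := (SmoothBumpFunction.nhds_basis_tsupport (I := 𝓡 (n + 1)) (c : N)).mem_iff.1
      ((hOo c).mem_nhds (hcO c))
    exact ⟨f, hf⟩
  choose f hf using hbump
  set χ : C → N → ℝ := fun c => f c with hχ_def
  have hχs : ∀ c, ContMDiff (𝓡 (n + 1)) 𝓘(ℝ, ℝ) ∞ (χ c) := fun c => (f c).contMDiff
  have hχsupp : ∀ c, tsupport (χ c) ⊆ (Ψ c).source := fun c => (hf c).trans (hOΨ c)
  have hχ1 : ∀ c : C, χ c =ᶠ[𝓝 (c : N)] fun _ => (1 : ℝ) := fun c => (f c).eventuallyEq_one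
  have hχ0 : ∀ c c' : C, c' ≠ c → χ c' =ᶠ[𝓝 (c : N)] fun _ => (0 : ℝ) := by
    intro c c' hne
    have hne' : (c : N) ≠ c' := fun h => hne (Subtype.ext h).symm
    have hd : Disjoint (U c) (U c') := hUdisj c.2 c'.2 hne'
    have hnot : (c : N) ∉ tsupport (χ c') := fun h =>
      Set.disjoint_left.1 hd (hU c).1 (hOU c' (hf c' h))
    exact notMem_tsupport_iff_eventuallyEq.1 hnot
  -- ### the distance function of the family `S`
  have hidxS : ∀ (c : C) (i : ι) (x), S.sphere i x ∈ tsupport (χ c) → i = iS c := by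
    intro c i x hx
    by_contra hne
    exact Set.disjoint_left.1 (S.disjoint_range hne) ⟨(x, 0), (S.sphere_apply i x).symm⟩
      (hOS c (hf c hx))
  have hplaneS : ∀ (c : C) (i : ι) (x), S.sphere i x ∈ tsupport (χ c) →
      (Ψ c (S.sphere i x)).2 = 0 := by
    intro c i x hx
    have hz : S.sphere i x ∈ (Ψ c).source := hχsupp c hx
    obtain rfl := hidxS c i x hx
    exact (hΨS c _ hz).1 (mem_range_self x)
  have hnormS : ∀ (c : C) (i : ι) (x), S.sphere i x ∈ tsupport (χ c) →
      HasFDerivAt (fun w : EuclideanSpace ℝ (Fin b) => (Ψ c (S.toFun i (x, w))).2)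
        (ContinuousLinearMap.id ℝ (EuclideanSpace ℝ (Fin b))) 0 := by
    intro c i x hx
    have hz : S.sphere i x ∈ (Ψ c).source := hχsupp c hx
    obtain rfl := hidxS c i x hx
    exact hΨnS c x hz
  obtain ⟨HS, τS, hτS, hHSs, hHS0, hHSz, hHSlt, hHSreg, hHSloc⟩ :=
    S.exists_familyDistance Ψ χ hΨsm hχs hχsupp hplaneS hnormS
  -- ### the distance function of the family `P` (charts with the factors exchanged)
  have hswap := fun c : C => exists_swap_chart (Ψ c) (hΨsm c) (hΨsm' c)
  choose Ψ' hΨ'src hΨ'apply hΨ'sm hΨ'sm' using hswap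
  have hχsupp' : ∀ c, tsupport (χ c) ⊆ (Ψ' c).source := fun c => by
    rw [hΨ'src]; exact hχsupp c
  have hidxP : ∀ (c : C) (j : ι') (y), P.sphere j y ∈ tsupport (χ c) → j = jP c := by
    intro c j y hy
    by_contra hne
    exact Set.disjoint_left.1 (P.disjoint_range hne) ⟨(y, 0), (P.sphere_apply j y).symm⟩
      (hOP c (hf c hy))
  have hplaneP : ∀ (c : C) (j : ι') (y), P.sphere j y ∈ tsupport (χ c) →
      (Ψ' c (P.sphere j y)).2 = 0 := by
    intro c j y hy
    have hz : P.sphere j y ∈ (Ψ c).source := hχsupp c hy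
    obtain rfl := hidxP c j y hy
    rw [hΨ'apply]
    exact (hΨP c _ hz).1 (mem_range_self y)
  have hnormP : ∀ (c : C) (j : ι') (y), P.sphere j y ∈ tsupport (χ c) →
      HasFDerivAt (fun w : EuclideanSpace ℝ (Fin a) => (Ψ' c (P.toFun j (y, w))).2)
        (ContinuousLinearMap.id ℝ (EuclideanSpace ℝ (Fin a))) 0 := by
    intro c j y hy
    have hz : P.sphere j y ∈ (Ψ c).source := hχsupp c hy
    obtain rfl := hidxP c j y hy
    have hfun : (fun w : EuclideanSpace ℝ (Fin a) => (Ψ' c (P.toFun (jP c) (y, w))).2) =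
        fun w => (Ψ c (P.toFun (jP c) (y, w))).1 := funext fun w => by rw [hΨ'apply]
    rw [hfun]
    exact hΨnP c y hz
  obtain ⟨HP, τP, hτP, hHPs, hHP0, hHPz, hHPlt, hHPreg, hHPloc⟩ :=
    P.exists_familyDistance Ψ' χ hΨ'sm hχs hχsupp' hplaneP hnormP
  have hHPloc' : ∀ c : C, ∀ z ∈ P.cores, χ c =ᶠ[𝓝 z] (fun _ => (1 : ℝ)) →
      (∀ c', c' ≠ c → χ c' =ᶠ[𝓝 z] fun _ => (0 : ℝ)) →
      HP =ᶠ[𝓝 z] fun y => ‖(Ψ c y).1‖ ^ 2 := by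
    intro c z hz h1 h0
    have hfun : (fun y => ‖(Ψ' c y).2‖ ^ 2) = fun y => ‖(Ψ c y).1‖ ^ 2 :=
      funext fun y => by rw [hΨ'apply]
    rw [← hfun]
    exact hHPloc c z hz h1 h0
  -- ### near the crossings both distance functions are chart coordinates
  set U₀ : Set N := {z | ∃ c : C, z ∈ (Ψ c).source ∧
    HS =ᶠ[𝓝 z] (fun y => ‖(Ψ c y).2‖ ^ 2) ∧ HP =ᶠ[𝓝 z] (fun y => ‖(Ψ c y).1‖ ^ 2)}
    with hU₀_def
  have hU₀o : IsOpen U₀ := by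
    rw [isOpen_iff_mem_nhds]
    rintro z ⟨c, hz, hS', hP'⟩
    filter_upwards [(Ψ c).open_source.mem_nhds hz, hS'.eventuallyEq_nhds, hP'.eventuallyEq_nhds]
      with y hy hyS hyP
    exact ⟨c, hy, hyS, hyP⟩
  have hcross : ∀ z, HS z ≤ 0 → HP z ≤ 0 → z ∈ U₀ := by
    intro z hzS hzP
    have hzS' : z ∈ S.cores := (hHSz z).1 (le_antisymm hzS (hHS0 z))
    have hzP' : z ∈ P.cores := (hHPz z).1 (le_antisymm hzP (hHP0 z))
    set c : C := ⟨z, hzS', hzP'⟩ with hc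
    exact ⟨c, hΨc' c, hHSloc c z hzS' (hχ1 c) (hχ0 c), hHPloc' c z hzP' (hχ1 c) (hχ0 c)⟩
  obtain ⟨η, hη, hηU⟩ := exists_pos_forall_le_le_mem hHSs.continuous hHPs.continuous hU₀o hcross
  -- ### the constants, the smooth minimum, the function `g`
  set m : ℝ := min η (min τS τP) with hm_def
  have hm0 : 0 < m := lt_min hη (lt_min hτS hτP)
  have hmη : m ≤ η := min_le_left _ _
  have hmS : m ≤ τS := (min_le_right _ _).trans (min_le_left _ _)
  have hmP : m ≤ τP := (min_le_right _ _).trans (min_le_right _ _)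
  set ε2 : ℝ := m / 2 with hε2_def
  set δ : ℝ := m / 4 with hδ_def
  have hε0 : 0 < ε2 := by positivity
  have hδ0 : 0 < δ := by positivity
  have hδε : δ < ε2 := by rw [hε2_def, hδ_def]; linarith
  have hεη : ε2 + δ ≤ η := by rw [hε2_def, hδ_def]; linarith
  have hεS : ε2 < τS := by rw [hε2_def]; linarith
  have hεP : ε2 < τP := by rw [hε2_def]; linarith
  obtain ⟨μ, hμs, hμ1, hμ2, hμ3, hμd⟩ := exists_smoothMin hδ0
  have hμu : ∀ u v, μ (u, v) ≤ u + δ := by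
    intro u v
    rcases le_or_gt v u with h | h
    · rw [hμ2 u v h]; linarith
    · rcases le_or_gt δ (v - u) with h' | h'
      · rw [hμ1 u v h']; linarith
      · have h3 := (hμ3 u v).2
        rw [max_eq_right h.le] at h3
        linarith
  have hμv : ∀ u v, μ (u, v) ≤ v := by
    intro u v
    rcases le_or_gt v u with h | h
    · rw [hμ2 u v h]
    · have h3 := (hμ3 u v).2
      rwa [max_eq_right h.le] at h3
  set g : N → ℝ := fun z => μ (HS z, HP z) - ε2 with hg_def
  have hpair : ContMDiff (𝓡 (n + 1)) 𝓘(ℝ, ℝ × ℝ) ∞ fun z => (HS z, HP z) :=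
    hHSs.prodMk_space hHPs
  have hgs : ContMDiff (𝓡 (n + 1)) 𝓘(ℝ, ℝ) ∞ g :=
    (hμs.contMDiff.comp hpair).sub contMDiff_const
  -- ### `0` is a regular level of `g`
  have hkey : ∀ z, g z = 0 → ¬ IsMCriticalPt (𝓡 (n + 1)) g z := by
    intro z hz
    have hμz : μ (HS z, HP z) = ε2 := by
      have : μ (HS z, HP z) - ε2 = 0 := hz
      linarith
    by_cases hv : η < HP z
    · -- far from `P_*`: `g = H_S - ε²` near `z`, a non-critical level of `H_S`
      have huv : δ < HP z - HS z ∧ HS z = ε2 := by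
        rcases le_or_gt (HP z) (HS z) with h | h
        · rw [hμ2 _ _ h] at hμz
          exfalso
          linarith
        · rcases le_or_gt δ (HP z - HS z) with h' | h'
          · rw [hμ1 _ _ h'] at hμz
            exact ⟨by linarith, hμz⟩
          · exfalso
            have h3 := (hμ3 (HS z) (HP z)).1
            rw [min_eq_left h.le] at h3
            linarith
      have hev : g =ᶠ[𝓝 z] fun y => HS y - ε2 := by
        have ho : IsOpen {y | δ < HP y - HS y} :=
          isOpen_lt continuous_const (hHPs.continuous.sub hHSs.continuous)
        filter_upwards [ho.mem_nhds huv.1] with y hy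
        show μ (HS y, HP y) - ε2 = HS y - ε2
        rw [hμ1 _ _ (le_of_lt hy)]
      have hreg : ¬ IsMCriticalPt (𝓡 (n + 1)) HS z :=
        hHSreg z (by rw [huv.2]; exact hε0) (by rw [huv.2]; exact hεS)
      exact not_isMCriticalPt_of_eventuallyEq_sub_const hev
        (hHSs.mdifferentiableAt (by simp)) hreg
    · push Not at hv
      by_cases hu : η < HS z
      · -- far from `S_*`: `g = H_P - ε²` near `z`, a non-critical level of `H_P`
        have hlt' : HP z < HS z := lt_of_le_of_lt hv hu
        have hHPz' : HP z = ε2 := by rw [hμ2 _ _ hlt'.le] at hμz; exact hμz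
        have hev : g =ᶠ[𝓝 z] fun y => HP y - ε2 := by
          have ho : IsOpen {y | HP y < HS y} := isOpen_lt hHPs.continuous hHSs.continuous
          filter_upwards [ho.mem_nhds hlt'] with y hy
          show μ (HS y, HP y) - ε2 = HP y - ε2
          rw [hμ2 _ _ (le_of_lt hy)]
        have hreg : ¬ IsMCriticalPt (𝓡 (n + 1)) HP z :=
          hHPreg z (by rw [hHPz']; exact hε0) (by rw [hHPz']; exact hεP)
        exact not_isMCriticalPt_of_eventuallyEq_sub_const hev
          (hHPs.mdifferentiableAt (by simp)) hreg
      · -- near a crossing: the corner computation in the adapted chart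
        push Not at hu
        obtain ⟨c, hzs, hS', hP'⟩ := hηU z hu hv
        have hpos : 0 < HS z ∧ 0 < HP z := by
          rcases le_or_gt (HP z) (HS z) with h | h
          · rw [hμ2 _ _ h] at hμz
            constructor <;> linarith
          · rcases le_or_gt δ (HP z - HS z) with h' | h'
            · rw [hμ1 _ _ h'] at hμz
              constructor <;> linarith
            · have h3 := (hμ3 (HS z) (HP z)).2
              rw [max_eq_right h.le] at h3
              constructor <;> linarith
        obtain ⟨s, hs⟩ := hμd (HS z) (HP z)
        exact not_isMCriticalPt_smoothMin_of_chart (Ψ c) (hΨsm c) (hΨsm' c) hzs hS' hP' hpos.1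
          hpos.2 hs ε2
  have hreg : IsRegularLevel (𝓡 (n + 1)) g 0 := isRegularLevel_of_not_isMCriticalPt hgs hkey
  -- ### thin tubes lie in `{g < 0}`
  have hVS : IsOpen {z | HS z < ε2 - δ} := isOpen_lt hHSs.continuous continuous_const
  have hVP : IsOpen {z | HP z < ε2 - δ} := isOpen_lt hHPs.continuous continuous_const
  have hcVS : ∀ i v, S.sphere i v ∈ {z | HS z < ε2 - δ} := fun i v => by
    show HS (S.sphere i v) < ε2 - δ
    rw [(hHSz _).2 (S.sphere_mem_cores i v)]
    linarith
  have hcVP : ∀ j v, P.sphere j v ∈ {z | HP z < ε2 - δ} := fun j v => by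
    show HP (P.sphere j v) < ε2 - δ
    rw [(hHPz _).2 (P.sphere_mem_cores j v)]
    linarith
  obtain ⟨rS, hrS, hrSm⟩ := S.exists_forall_norm_le_apply_mem hVS hcVS
  obtain ⟨rP, hrP, hrPm⟩ := P.exists_forall_norm_le_apply_mem hVP hcVP
  set r : ℝ := min 1 (min rS rP) with hr_def
  have hr0 : 0 < r := lt_min one_pos (lt_min hrS hrP)
  have hr1 : r ≤ 1 := min_le_left _ _
  have hrS' : r ≤ rS := (min_le_right _ _).trans (min_le_left _ _)
  have hrP' : r ≤ rP := (min_le_right _ _).trans (min_le_right _ _)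
  refine ⟨g, r, hreg, hr0, hr1, fun i v w hw => ?_, fun j v w hw => ?_, fun z hz => ?_⟩
  · have h1 : HS (S.toFun i (v, w)) < ε2 - δ := hrSm i v w (hw.trans hrS')
    show μ (HS (S.toFun i (v, w)), HP (S.toFun i (v, w))) - ε2 < 0
    linarith [hμu (HS (S.toFun i (v, w))) (HP (S.toFun i (v, w)))]
  · have h1 : HP (P.toFun j (v, w)) < ε2 - δ := hrPm j v w (hw.trans hrP')
    show μ (HS (P.toFun j (v, w)), HP (P.toFun j (v, w))) - ε2 < 0
    linarith [hμv (HS (P.toFun j (v, w))) (HP (P.toFun j (v, w)))]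
  · -- `{g ≤ 0}` lies in the union of the open tubes
    have h1 : μ (HS z, HP z) ≤ ε2 := by
      have : μ (HS z, HP z) - ε2 ≤ 0 := hz
      linarith
    have h2 := (hμ3 (HS z) (HP z)).1
    rcases le_total (HS z) (HP z) with h | h
    · rw [min_eq_left h] at h2
      exact Or.inl (hHSlt z (by linarith))
    · rw [min_eq_right h] at h2
      exact Or.inr (hHPlt z (by linarith))

end FramedSphereFamily

end Literature.Topology.FourManifolds

end
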